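import Literature.AlgebraicGeometry.ShimuraVarieties.SiegelBorelExtension
import Literature.AlgebraicGeometry.ShimuraVarieties.UnitaryAuxiliaryComplexStructure
import Literature.AlgebraicGeometry.ShimuraVarieties.UnitaryBallAutomorphicForms
import Literature.NumberTheory.ModularForms.SiegelSymplecticVolume
import HarnessLib

/-!
# The holomorphic Siegel lift of a ball slice: a point map `[x, aK_V] ↦ [J(x), b(a)·K_δ(N)]` into the
# Siegel modular variety has holomorphic Siegel lifts as soon as `x ↦ J(x)` has a holomorphic period chart
# ([Deligne 1979] Prop. 2.3.10; [Milne ISV] Thm. 5.16 «obvious from (3.14)»; S2pair-β of the I-1′ receptacle)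

Topic `AlgebraicGeometry/ShimuraVarieties`; namespace `Literature.AlgebraicGeometry.ShimuraVarieties`.
THEOREMS ONLY (no `def`, no named fact, no instance, no `sorry`).  Cell `hodgecm-mathlib`, crux `HDel`
(stmt-HodgeConjecture-24835), T3 v4.1 `stub_S2pair : QArch.S2Pair` (B-plan2 g5, 2026-08-28T15:25:46Z): S2pair = α (the point
map is well defined on double cosets, B-p09) + **β (THIS FILE: the point map has holomorphic Siegel lifts)** + γ (assembly with the
(σ5) named fact ★ `siegel_borel_extension.exists_sigmaDesc`).

THE PRINT.  [Milne2005ShimuraVarieties] Thm. 5.16 (notes ed. p0056 L15–L19): «A morphism of Shimura data … defines a morphism … of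
Shimura varieties [PROOF: obvious from (3.14)]» — i.e. the map induced on `X × G(𝔸_f)/K` by a morphism of Shimura data is holomorphic
on each connected component `X⁺ × {a}`, because `X → X'` is a holomorphic map of hermitian symmetric domains; Borel's theorem (3.14)
then makes it algebraic.  [Deligne1979ShimuraVarieties] Prop. 2.3.10: the symplectic embedding of a Hodge-type datum into
`(GSp(V, ψ), S^±)`.  Here: the SLICE-WISE holomorphy («obvious»), in the charts of the tree's two record systems.

WHAT IS PROVED.  SOURCE: the complex record system `Sc` of `Sh(U(H), 𝔹²)` below a small level (★ `UnitaryCanonicalModel.ComplexRecordSystem`)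
at a level `K`; TARGET: any Siegel complex record system `Sg` (★ (σ3) `SiegelComplexRecordSystem g δ`, `0 < g`, `0 < δᵢ`) at any principal
level `KN`.  §SliceLift (generic, any family `J : 𝔹² → X⁻ = -C0 δ`, adelic translates `b a ∈ GSp_δ(𝔸_f)` per slice `a`, point map
`f : Sc.Mc_K(ℂ) → Sg.Mc_{KN}(ℂ)` with `f((Sc.pts K)⁻¹[x, aK]) = (Sg.pts KN)⁻¹[J(x), b(a)·KN]`):
* `hasHolomorphicSiegelLift_of_negConeChart` — `HasHolomorphicSiegelLift Sc K Sg KN f` (★ (σ5) `SiegelBorelExtension.lean` :113) from a matrix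
  lift `Z`, holomorphic on the negative cone of `H^τ`, of `γ J γ⁻¹` for every real similitude `γ` moving `J` into `X⁺` (hypothesis `hZ`);
* `negConeChart_of_ballChart` — such a `Z` from a chart `P` on the affine ball `𝔹² ⊆ ℂ²` in Klingen coordinates (★ `coordCLE`,
  ★ `siegelUpperHalfSpaceCoord`): `Z(v) := Z_{P(w₀/w₂, w₁/w₂)}`, `w = T⁻¹v` (`w₂ ≠ 0` on the negative cone since `Tᴴ H^τ T = diag(1,1,-1)`);
* `hasHolomorphicSiegelLift_of_periodChart` — the two combined (hypothesis `hP` = B-p05's TARGET 1 `UnitaryAuxiliaryPeriodMap` export shape of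
  2026-08-28T15:26Z with its immersion clause dropped).
At the auxiliary datum ([Deligne 1979] Prop. 2.3.10, `J_{β,Φ}` = ★ (g-b) `auxComplexStructure F τ Φ T`, in `X⁻` by ★ `neg_auxComplexStructure_mem_C0`):
* `hasHolomorphicSiegelLift_auxSlice` — for a fixed torus parameter `t`, any point map acting on the slices by `[x, aK_V] ↦ [J_{β,Φ}(x), ũ_β(a,t)·KN]`
  (one per class `[t]`, leaf α ★ `exists_siegelPointMap`) has holomorphic Siegel lifts, given the ball period chart of `J_{β,Φ}` — the `hf`
  input of ★ `siegel_borel_extension.exists_sigmaDesc` in the γ-assembly `Theorems/F1ExtHodgeTypeStubS2Pair.lean` (line of record, B-plan2 g5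
  2026-08-28T15:43:08Z (a)).

PROOF of the slice lift (the «obvious» of Thm. 5.16, made of ★ bookkeeping).  Fix the slice `a`.  (1) The point `(Sg.pts KN)⁻¹[J(x₀), b(a)KN]`
lies on some piece `q` and is a moduli point `[J(Z₀), rep q·KN]` (★ `Sg.exists_pts_eq_mk`), so some `γ ∈ GSp_δ(ℚ)` has `γ J(Z₀) γ⁻¹ = J(x₀)`
and `γ·rep q·KN = b(a)·KN` (★ `SiegelShimuraSet.mk_eq_mk_iff`).  (2) `γ⁻¹` has NEGATIVE multiplier: `γ⁻¹J(x₀)γ = J(Z₀) ∈ X⁺` while `J(x₀) ∈ X⁻`,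
and a positive multiplier preserves the halves (★ `conjJ_mem_C0_of_pos`, ★ `neg_not_mem_C0_of_mem_C0`); hence `γ⁻¹ J(x) γ ∈ X⁺` for EVERY `x`
(★ `neg_conjJ_mem_C0_of_neg`) — the piece `q` and the translate `γ` are constant along the slice.  (3) The lift `Z` for `γ⁻¹` has
`Z(T·(x,1)) ∈ 𝔥_g` and `[J(x), b(a)KN] = [γ J(Z(T(x,1))) γ⁻¹, γ·rep q·KN] = [J(Z(T(x,1))), rep q·KN] = Sg.pts KN (incl q (unif Z(T(x,1))))`
(★ `Sg.incl_unif`).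

Build-touch 2026-08-28T16:25Z (stale olean after p646597; director s81 precedent p641946): no declaration changed.

HC_CM is proved only modulo the 7 printed citations until rung 0 closes; this file discharges none of them (it is one input of the
T3 stub `S2pair`, whose other inputs are the (σ5) NAMED FACT and B-p05's period chart).

## References
* [Milne2005ShimuraVarieties] J. S. Milne, *Introduction to Shimura varieties* (2005; notes ed. `paper:doi-10-1307-mmj-1030132370`),
  Thm. 5.16 with Def. 5.15 (p0056 L9–L19), Thm. 3.14 (p0039), §6 pp. 67–70 (the Siegel double space `X = X⁺ ⊔ X⁻`), Lemma 5.13 p. 57.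
* [Deligne1979ShimuraVarieties] P. Deligne, *Variétés de Shimura* (1979), Prop. 2.3.10; 1.3.1.
* [Lange2023AbelianVarietiesComplex] H. Lange, *Abelian Varieties over the Complex Numbers* (2023), §7.1.2 (p0326–p0328) (`Z ↦ J_Z`).
-/

set_option autoImplicit false

noncomputable section

open Function MulAction Topology NumberField IsDedekindDomain CategoryTheory CategoryTheory.Limits Matrix
  AlgebraicGeometry
open scoped Matrix ComplexOrder
open Literature.AlgebraicGeometry.Motives
open Literature.NumberTheory.Automorphic Literature.NumberTheory.Automorphic.UnitaryGroup
open Literature.NumberTheory.Automorphic.ShimuraDissection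
open Literature.NumberTheory.Automorphic.Liu2021.AppendixC (C5.OpenCompactSubgroup C5.SmallLevel)
open Literature.Geometry.ComplexHyperbolic Literature.Geometry.ComplexHyperbolic.BallModel
open Literature.AlgebraicGeometry.ModuliOfAbelianVarieties
open Literature.AlgebraicGeometry.ModuliOfAbelianVarieties.SiegelModuli (C0 mem_C0_iff siegelOfJ jOfSiegel jOfSiegel_mem_C0)
open Literature.NumberTheory.ModularForms.SiegelUpperHalfSpace (coordCLE siegelUpperHalfSpaceCoord mem_siegelUpperHalfSpaceCoord_iff
  coe_coordCLE_symm_apply)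
open Literature.LinearAlgebra.Matrix (symmetricSubmodule)

namespace Literature.AlgebraicGeometry.ShimuraVarieties

open Literature.AlgebraicGeometry.ShimuraVarieties.UnitaryCanonicalModel
open Literature.AlgebraicGeometry.ShimuraVarieties.UnitaryCanonicalModel.Aux

section SliceLift

variable {L : Type} [Field L] [NumberField L] [IsCMField L]
variable {H : Matrix (Fin 3) (Fin 3) L} {τ : L →+* ℂ} {T : GL (Fin 3) ℂ}
  {hT : formCongr (starRingEnd ℂ) T (H.map τ) = BallModel.J}
  {K₀ : C5.OpenCompactSubgroup ↥(finAdelic (↥(maximalRealSubfield L)) L (IsCMField.complexConj L) 3 H)}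
variable {g : ℕ} {δ : Fin g → ℕ}

omit [NumberField L] [IsCMField L] in
/-- In the frame `T` (`Tᴴ H^τ T = diag(1,1,-1)`) the hermitian square of `T w` is `Q(w) = |w₀|² + |w₁|² - |w₂|²` (private twin of the
tree's `hermForm_frame_apply`). [cite: Milne2005ShimuraVarieties, Def. 12.5 p. 113] -/
private theorem hermForm_frame_apply_aux (hT : formCongr (starRingEnd ℂ) T (H.map τ) = BallModel.J) (w : Fin 3 → ℂ) :
    hermForm (starRingEnd ℂ) (H.map τ) ((T : Matrix (Fin 3) (Fin 3) ℂ) *ᵥ w) ((T : Matrix (Fin 3) (Fin 3) ℂ) *ᵥ w) =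
      ((Q w : ℝ) : ℂ) := by
  rw [hermForm_starRingEnd, ← form_eq_Q, ← hT, star_mulVec, ← dotProduct_mulVec, mulVec_mulVec, mulVec_mulVec]
  rfl

omit [NumberField L] [IsCMField L] in
/-- A negative vector `v` of `H^τ` read back through the frame, `w = T⁻¹ v`, is `J`-negative: `Q(T⁻¹v) < 0` (so `w₂ ≠ 0` and
`(w₀/w₂, w₁/w₂)` is a point of the ball). [cite: Milne2005ShimuraVarieties, Def. 12.5 p. 113] -/
private theorem Q_inv_mulVec_neg (hT : formCongr (starRingEnd ℂ) T (H.map τ) = BallModel.J) {v : Fin 3 → ℂ}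
    (hv : v ∈ negCone (H.map τ)) : Q (((T⁻¹ : GL (Fin 3) ℂ) : Matrix (Fin 3) (Fin 3) ℂ) *ᵥ v) < 0 := by
  have hTv : (T : Matrix (Fin 3) (Fin 3) ℂ) *ᵥ (((T⁻¹ : GL (Fin 3) ℂ) : Matrix (Fin 3) (Fin 3) ℂ) *ᵥ v) = v := by
    rw [mulVec_mulVec, ← Units.val_mul, mul_inv_cancel, Units.val_one, one_mulVec]
  have h := hermForm_frame_apply_aux hT (((T⁻¹ : GL (Fin 3) ℂ) : Matrix (Fin 3) (Fin 3) ℂ) *ᵥ v)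
  rw [hTv] at h
  have hre := hv
  rw [mem_negCone_iff, ← hermForm_starRingEnd, h, Complex.ofReal_re] at hre
  exact hre

/-- The affine chart `w ↦ (w₀/w₂, w₁/w₂)` is holomorphic off `w₂ = 0`. [cite: Milne2005ShimuraVarieties, §6 p. 67] -/
private theorem differentiableOn_ballChart :
    DifferentiableOn ℂ (fun w : Fin 3 → ℂ => (![w 0 / w 2, w 1 / w 2] : Fin 2 → ℂ)) {w | w 2 ≠ 0} := by
  have h2 : DifferentiableOn ℂ (fun w : Fin 3 → ℂ => (w 2)⁻¹) {w | w 2 ≠ 0} :=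
    (differentiable_apply (𝕜 := ℂ) (2 : Fin 3)).differentiableOn.inv fun w hw => hw
  have h0 : DifferentiableOn ℂ (fun w : Fin 3 → ℂ => w 0 / w 2) {w | w 2 ≠ 0} := by
    simpa only [div_eq_mul_inv, Pi.mul_def] using (differentiable_apply (𝕜 := ℂ) (0 : Fin 3)).differentiableOn.mul h2
  have h1 : DifferentiableOn ℂ (fun w : Fin 3 → ℂ => w 1 / w 2) {w | w 2 ≠ 0} := by
    simpa only [div_eq_mul_inv, Pi.mul_def] using (differentiable_apply (𝕜 := ℂ) (1 : Fin 3)).differentiableOn.mul h2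
  refine differentiableOn_pi.2 fun i => ?_
  fin_cases i
  · simpa using h0
  · simpa using h1

omit [NumberField L] [IsCMField L] in
/-- **Ball chart ⇒ negative-cone chart** (pure bookkeeping through the frame): a period chart `P` on the affine ball `𝔹² ⊆ ℂ²` in
Klingen coordinates (★ `coordCLE`, ★ `siegelUpperHalfSpaceCoord`) gives the matrix-valued lift `Z(v) := Z_{P(w₀/w₂, w₁/w₂)}`, `w = T⁻¹v`,
holomorphic entrywise on the negative cone of `H^τ` (`w₂ ≠ 0` there, since `Tᴴ H^τ T = diag(1,1,-1)`), with `Z(T·(x,1)) = Z_{P(x)} ∈ 𝔥_g`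
— the currency of ★ `HasHolomorphicSiegelLift`. [cite: Milne2005ShimuraVarieties, §6 pp. 67–68; Lemma 5.13 p. 57] -/
theorem negConeChart_of_ballChart (hT : formCongr (starRingEnd ℂ) T (H.map τ) = BallModel.J)
    {J : Ball → Matrix (Fin g ⊕ Fin g) (Fin g ⊕ Fin g) ℝ} {γ : GL (Fin g ⊕ Fin g) ℝ}
    (hP : ∃ P : (Fin 2 → ℂ) → (Sym2 (Fin g) → ℂ), DifferentiableOn ℂ P BallForms.ballSet ∧
      ∀ x : Ball, P x.1 ∈ siegelUpperHalfSpaceCoord g ∧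
        conjJ γ (J x) = jOfSiegel δ (((coordCLE g).symm (P x.1) : symmetricSubmodule (Fin g) ℂ) : Matrix (Fin g) (Fin g) ℂ)) :
    ∃ Z : (Fin 3 → ℂ) → Matrix (Fin g) (Fin g) ℂ,
      (∀ i j : Fin g, DifferentiableOn ℂ (fun v => Z v i j) (negCone (H.map τ))) ∧
        ∀ x : Ball, Z ((T : Matrix (Fin 3) (Fin 3) ℂ) *ᵥ BallModel.lift x) ∈ siegelUpperHalfSpace g ∧
          conjJ γ (J x) = jOfSiegel δ (Z ((T : Matrix (Fin 3) (Fin 3) ℂ) *ᵥ BallModel.lift x)) := by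
  obtain ⟨P, hPd, hPx⟩ := hP
  let bc : (Fin 3 → ℂ) → (Fin 2 → ℂ) := fun w => ![w 0 / w 2, w 1 / w 2]
  let Ti : Matrix (Fin 3) (Fin 3) ℂ := ((T⁻¹ : GL (Fin 3) ℂ) : Matrix (Fin 3) (Fin 3) ℂ)
  let Z : (Fin 3 → ℂ) → Matrix (Fin g) (Fin g) ℂ := fun v =>
    (((coordCLE g).symm (P (bc (Ti *ᵥ v))) : symmetricSubmodule (Fin g) ℂ) : Matrix (Fin g) (Fin g) ℂ)
  have hTi : ∀ x : Ball, Ti *ᵥ ((T : Matrix (Fin 3) (Fin 3) ℂ) *ᵥ BallModel.lift x) = BallModel.lift x := fun x => by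
    rw [mulVec_mulVec, ← Units.val_mul, inv_mul_cancel, Units.val_one, one_mulVec]
  have hbc : ∀ x : Ball, bc (BallModel.lift x) = x.1 := fun x => by
    ext i
    fin_cases i <;> simp [bc]
  have hZx : ∀ x : Ball, Z ((T : Matrix (Fin 3) (Fin 3) ℂ) *ᵥ BallModel.lift x) =
      (((coordCLE g).symm (P x.1) : symmetricSubmodule (Fin g) ℂ) : Matrix (Fin g) (Fin g) ℂ) := fun x => by
    change (((coordCLE g).symm (P (bc (Ti *ᵥ ((T : Matrix (Fin 3) (Fin 3) ℂ) *ᵥ BallModel.lift x)))) :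
      symmetricSubmodule (Fin g) ℂ) : Matrix (Fin g) (Fin g) ℂ) = _
    rw [hTi, hbc]
  refine ⟨Z, fun i j => ?_, fun x => ⟨?_, ?_⟩⟩
  · -- holomorphy of the entries on the negative cone
    have hlin : Differentiable ℂ fun v : Fin 3 → ℂ => Ti *ᵥ v :=
      (LinearMap.toContinuousLinearMap (Matrix.mulVecLin Ti)).differentiable
    have hmaps₁ : Set.MapsTo (fun v : Fin 3 → ℂ => Ti *ᵥ v) (negCone (H.map τ)) {w | w 2 ≠ 0} := fun v hv =>
      ne_zero_of_Q_neg (Q_inv_mulVec_neg hT hv)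
    have hmaps₂ : Set.MapsTo (fun v : Fin 3 → ℂ => bc (Ti *ᵥ v)) (negCone (H.map τ)) BallForms.ballSet := fun v hv =>
      (proj (Ti *ᵥ v) (Q_inv_mulVec_neg hT hv)).2
    have h1 : DifferentiableOn ℂ (fun v : Fin 3 → ℂ => bc (Ti *ᵥ v)) (negCone (H.map τ)) :=
      differentiableOn_ballChart.comp hlin.differentiableOn hmaps₁
    have h2 : DifferentiableOn ℂ (fun v : Fin 3 → ℂ => P (bc (Ti *ᵥ v))) (negCone (H.map τ)) := hPd.comp h1 hmaps₂
    have h3 : DifferentiableOn ℂ ((fun u : Sym2 (Fin g) → ℂ => u s(i, j)) ∘ fun v : Fin 3 → ℂ => P (bc (Ti *ᵥ v)))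
        (negCone (H.map τ)) :=
      (differentiable_apply (𝕜 := ℂ) (s(i, j) : Sym2 (Fin g))).comp_differentiableOn h2
    exact h3.congr fun v _ => rfl
  · rw [hZx]
    exact (mem_siegelUpperHalfSpaceCoord_iff).1 (hPx x).1
  · rw [hZx]
    exact (hPx x).2

/-- **The holomorphic Siegel lift of a ball slice, negative-cone currency.**  For a family of symplectic complex structures
`J : 𝔹² → X⁻` (`-J x ∈ C0 δ`) with, for every `γ ∈ GSp_δ(ℝ)` moving it into `X⁺`, a matrix lift `Z` holomorphic on the negative cone
of `H^τ` (`hZ`, the `HasHolomorphicSiegelLift` currency), and adelic translates `b a`, every point map `f : Sc.Mc_K(ℂ) → Sg.Mc_{KN}(ℂ)`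
acting on the slices by `[x, aK] ↦ [J(x), b(a)·KN]` has holomorphic Siegel lifts: the piece `q` and the rational translate `γ` are
CONSTANT along each slice (negative multiplier; `X = X⁺ ⊔ X⁻`). [cite: Milne2005ShimuraVarieties, Thm. 5.16 with Def. 5.15 (notes ed. p0056 L9–L19); §6 pp. 67–70; Lemma 5.13 p. 57]
[cite: Deligne1979ShimuraVarieties, Prop. 2.3.10] -/
theorem hasHolomorphicSiegelLift_of_negConeChart (Sc : ComplexRecordSystem L H τ T hT K₀) (K : C5.SmallLevel K₀)
    (hg : 0 < g) (hδ : ∀ i, 0 < δ i) (Sg : SiegelComplexRecordSystem g δ) (KN : SiegelLevel δ)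
    (J : Ball → Matrix (Fin g ⊕ Fin g) (Fin g ⊕ Fin g) ℝ) (hJ : ∀ x : Ball, J x ∈ C0pm δ) (hJneg : ∀ x : Ball, -J x ∈ C0 δ)
    (hZ : ∀ γ : GL (Fin g ⊕ Fin g) ℝ, γ ∈ gspReal δ → (∀ x : Ball, conjJ γ (J x) ∈ C0 δ) →
      ∃ Z : (Fin 3 → ℂ) → Matrix (Fin g) (Fin g) ℂ,
        (∀ i j : Fin g, DifferentiableOn ℂ (fun v => Z v i j) (negCone (H.map τ))) ∧
          ∀ x : Ball, Z ((T : Matrix (Fin 3) (Fin 3) ℂ) *ᵥ BallModel.lift x) ∈ siegelUpperHalfSpace g ∧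
            conjJ γ (J x) = jOfSiegel δ (Z ((T : Matrix (Fin 3) (Fin 3) ℂ) *ᵥ BallModel.lift x)))
    (b : finAdelic (↥(maximalRealSubfield L)) L (IsCMField.complexConj L) 3 H → gspFinAdelic δ)
    (f : ComplexPoints (Sc.Mc.obj K) → ComplexPoints (Sg.Mc.obj KN))
    (hf : ∀ (x : Ball) (a : finAdelic (↥(maximalRealSubfield L)) L (IsCMField.complexConj L) 3 H),
      f ((Sc.pts K).symm (ShimuraSet.mk L H τ T hT K.1.1 x a)) =
        (Sg.pts KN).symm (SiegelShimuraSet.mk δ KN.1 ⟨J x, hJ x⟩ (b a))) :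
    HasHolomorphicSiegelLift Sc K Sg KN f := by
  intro a
  -- (1) the piece and the rational translate at the base point `x₀`
  obtain ⟨q, Z₀, hZ₀, hq⟩ :=
    Sg.exists_pts_eq_mk hδ KN ((Sg.pts KN).symm (SiegelShimuraSet.mk δ KN.1 ⟨J x₀, hJ x₀⟩ (b a)))
  rw [Equiv.apply_symm_apply] at hq
  obtain ⟨γ, hγJ, hγb⟩ := (SiegelShimuraSet.mk_eq_mk_iff δ KN.1 _ _ _ _).1 hq
  -- `γ⁻¹ J(x₀) γ = J(Z₀) ∈ X⁺`
  set M : ↥(gspReal δ) := (gspRationalToReal δ γ)⁻¹ with hM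
  have hMJ₀ : conjJ (M : GL (Fin g ⊕ Fin g) ℝ) (J x₀) = jOfSiegel δ Z₀ := by
    have h := congrArg (fun J' : C0pm δ => (J' : Matrix (Fin g ⊕ Fin g) (Fin g ⊕ Fin g) ℝ)) hγJ
    simp only [coe_conjAct] at h
    rw [hM, Subgroup.coe_inv, ← h, ← conjJ_mul, inv_mul_cancel, conjJ_one]
  -- (2) `γ⁻¹` has negative multiplier, hence moves the whole slice into `X⁺`
  have hMC0 : ∀ x : Ball, conjJ (M : GL (Fin g ⊕ Fin g) ℝ) (J x) ∈ C0 δ := by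
    obtain ⟨ν, hν⟩ := exists_isMultiplier_realTypeForm M.2
    rcases lt_or_gt_of_ne (Units.ne_zero ν) with hneg | hpos
    · intro x
      have h := neg_conjJ_mem_C0_of_neg hν hneg (hJneg x)
      rwa [conjJ_neg, neg_neg] at h
    · exfalso
      have h := conjJ_mem_C0_of_pos hν hpos (hJneg x₀)
      rw [conjJ_neg, hMJ₀] at h
      exact neg_not_mem_C0_of_mem_C0 hg (jOfSiegel_mem_C0 hδ hZ₀) h
  -- (3) the lift for `γ⁻¹`
  obtain ⟨Z, hZd, hZx⟩ := hZ (M : GL (Fin g ⊕ Fin g) ℝ) M.2 hMC0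
  refine ⟨q, Z, hZd, fun x => ⟨(hZx x).1, ?_⟩⟩
  -- (4) the point identity
  rw [hf, Sg.incl_unif KN q _ (SiegelComplexRecordSystem.jOfSiegel_mem_C0pm hδ (hZx x).1) (hZx x).1]
  congr 1
  refine (SiegelShimuraSet.mk_eq_mk_iff δ KN.1 _ _ _ _).2 ⟨γ, Subtype.ext ?_, hγb⟩
  rw [coe_conjAct]
  change conjJ _ (jOfSiegel δ (Z ((T : Matrix (Fin 3) (Fin 3) ℂ) *ᵥ BallModel.lift x))) = J x
  rw [← (hZx x).2, hM, Subgroup.coe_inv, ← conjJ_mul, mul_inv_cancel, conjJ_one]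

/-- **The holomorphic Siegel lift of a ball slice, ball-chart currency** (B-p05's `UnitaryAuxiliaryPeriodMap` export shape, immersion
clause not needed): the same with the period chart given on the affine ball in Klingen coordinates; reduced to the negative-cone form by
`negConeChart_of_ballChart`. [cite: Milne2005ShimuraVarieties, Thm. 5.16 with Def. 5.15 (notes ed. p0056 L9–L19); §6 pp. 67–70]
[cite: Deligne1979ShimuraVarieties, Prop. 2.3.10] -/
theorem hasHolomorphicSiegelLift_of_periodChart (Sc : ComplexRecordSystem L H τ T hT K₀) (K : C5.SmallLevel K₀)
    (hg : 0 < g) (hδ : ∀ i, 0 < δ i) (Sg : SiegelComplexRecordSystem g δ) (KN : SiegelLevel δ)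
    (J : Ball → Matrix (Fin g ⊕ Fin g) (Fin g ⊕ Fin g) ℝ) (hJ : ∀ x : Ball, J x ∈ C0pm δ) (hJneg : ∀ x : Ball, -J x ∈ C0 δ)
    (hP : ∀ γ : gspReal δ, (∀ x : Ball, conjJ (γ : GL (Fin g ⊕ Fin g) ℝ) (J x) ∈ C0 δ) →
      ∃ P : (Fin 2 → ℂ) → (Sym2 (Fin g) → ℂ), DifferentiableOn ℂ P BallForms.ballSet ∧
        ∀ x : Ball, P x.1 ∈ siegelUpperHalfSpaceCoord g ∧
          conjJ (γ : GL (Fin g ⊕ Fin g) ℝ) (J x) =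
            jOfSiegel δ (((coordCLE g).symm (P x.1) : symmetricSubmodule (Fin g) ℂ) : Matrix (Fin g) (Fin g) ℂ))
    (b : finAdelic (↥(maximalRealSubfield L)) L (IsCMField.complexConj L) 3 H → gspFinAdelic δ)
    (f : ComplexPoints (Sc.Mc.obj K) → ComplexPoints (Sg.Mc.obj KN))
    (hf : ∀ (x : Ball) (a : finAdelic (↥(maximalRealSubfield L)) L (IsCMField.complexConj L) 3 H),
      f ((Sc.pts K).symm (ShimuraSet.mk L H τ T hT K.1.1 x a)) =
        (Sg.pts KN).symm (SiegelShimuraSet.mk δ KN.1 ⟨J x, hJ x⟩ (b a))) :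
    HasHolomorphicSiegelLift Sc K Sg KN f :=
  hasHolomorphicSiegelLift_of_negConeChart Sc K hg hδ Sg KN J hJ hJneg
    (fun γ hγ hC => negConeChart_of_ballChart (hT := hT) (hP ⟨γ, hγ⟩ hC)) b f hf

/-- **S2pair-β at the auxiliary datum** ([Deligne 1979] Prop. 2.3.10's `J_{β,Φ}` = ★ (g-b) `auxComplexStructure`, which lies in
`X⁻` by ★ `neg_auxComplexStructure_mem_C0` under the tree's sign conventions): for a fixed torus parameter `t`, any point map acting on
the slices by `[x, aK_V] ↦ [J_{β,Φ}(x), ũ_β(a, t)·KN]` (α: ★ `exists_siegelPointMap` makes one per class `[t]`) has holomorphic Siegel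
lifts, GIVEN the period chart `hP` of `J_{β,Φ}` (B-p05's `UnitaryAuxiliaryPeriodMap` export, immersion clause not needed).  This is the
`hf` input of ★ `siegel_borel_extension.exists_sigmaDesc` for the summand `p = [t]`, i.e. what the γ-assembly of `stub_S2pair` consumes.
[cite: Deligne1979ShimuraVarieties, Prop. 2.3.10] [cite: Milne2005ShimuraVarieties, Thm. 5.16 (notes ed. p0056 L15–L19); §6 pp. 67–70] -/
theorem hasHolomorphicSiegelLift_auxSlice (Sc : ComplexRecordSystem L H τ T hT K₀) (K : C5.SmallLevel K₀)
    (hpos : ∀ τ' : L →+* ℂ, InfinitePlace.mk τ' ≠ InfinitePlace.mk τ → (H.map τ').PosDef)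
    {M : Type} [Field M] [NumberField M] [IsCMField M] {j : L →+* M} (Φ : CMType M) (hΦ : IsExtAdapted τ j Φ)
    {ξ₀ ξ : M} (hξ₀ : ∀ ρ : Φ.1, (ρ.1 ξ₀).im < 0) (hξ : ∀ ρ : Φ.1, (ρ.1 ξ).im < 0)
    (hg : 0 < g) (hδ : ∀ i, 0 < δ i) (F : SymplecticFrame M j H ξ₀ ξ g δ)
    (hJ : ∀ x : Ball, auxComplexStructure F τ Φ T x ∈ C0pm δ) (Sg : SiegelComplexRecordSystem g δ) (KN : SiegelLevel δ)
    (hP : ∀ γ : gspReal δ, (∀ x : Ball, conjJ (γ : GL (Fin g ⊕ Fin g) ℝ) (auxComplexStructure F τ Φ T x) ∈ C0 δ) →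
      ∃ P : (Fin 2 → ℂ) → (Sym2 (Fin g) → ℂ), DifferentiableOn ℂ P BallForms.ballSet ∧
        ∀ x : Ball, P x.1 ∈ siegelUpperHalfSpaceCoord g ∧
          conjJ (γ : GL (Fin g ⊕ Fin g) ℝ) (auxComplexStructure F τ Φ T x) =
            jOfSiegel δ (((coordCLE g).symm (P x.1) : symmetricSubmodule (Fin g) ℂ) : Matrix (Fin g) (Fin g) ℂ))
    (t : ↥(torusFinAdelic M)) (f : ComplexPoints (Sc.Mc.obj K) → ComplexPoints (Sg.Mc.obj KN))
    (hf : ∀ (x : Ball) (a : finAdelic (↥(maximalRealSubfield L)) L (IsCMField.complexConj L) 3 H),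
      f ((Sc.pts K).symm (ShimuraSet.mk L H τ T hT K.1.1 x a)) =
        (Sg.pts KN).symm (SiegelShimuraSet.mk δ KN.1 ⟨auxComplexStructure F τ Φ T x, hJ x⟩ (auxToGspFin F (a, t)))) :
    HasHolomorphicSiegelLift Sc K Sg KN f :=
  hasHolomorphicSiegelLift_of_periodChart Sc K hg hδ Sg KN (fun x => auxComplexStructure F τ Φ T x) hJ
    (fun x => neg_auxComplexStructure_mem_C0 F τ Φ T x hT hξ₀ hξ hpos hΦ) hP (fun a => auxToGspFin F (a, t)) f hf

end SliceLift


end Literature.AlgebraicGeometry.ShimuraVarieties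

end
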